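import Literature.AlgebraicGeometry.Resolution.Dehomogenization
import Mathlib.RingTheory.IntegralClosure.IsIntegralClosure.Basic
import Mathlib.RingTheory.IntegralClosure.IntegrallyClosed
import Mathlib.RingTheory.Localization.FractionRing
import Mathlib.Algebra.MvPolynomial.Equiv
import Mathlib.FieldTheory.Finiteness
import HarnessLib

/-!
# Two pieces of commutative algebra behind [CoP1] Lemma 4.3 (4) (the curve `Γ′`): an integral rational element of an
# integrally closed domain lies in it; a root of a dehomogenised binary form with unit top coefficient is integral

Topic: `Literature/AlgebraicGeometry/Resolution` (algebra for `CurveCentreNearPointGammaPrimeRegular.lean`, the F-71 stub T2b′ of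
cell res-hironaka).  Both statements are textbook (Matsumura §9: integrally closed domains; integral elements):

* `exists_algebraMap_eq_of_isIntegral_of_mul_eq` — `S` an integrally closed domain, `S → K` injective into a field, `t ∈ K` integral
  over `S` with `c t = b` (`b, c ∈ S`, `c ≠ 0`) ⇒ `t ∈ S`;
* `isIntegral_of_eval₂_dehomogenize_eq_zero` — for a form `F ∈ R[Y_0, Y_1]` of degree `μ` whose `Y_l^μ`-coefficient becomes a unit
  in `A`, a zero `t ∈ K` of `F(Y_j := 1)` (read through `R → A → K`) is integral over `A` (the dehomogenised form, read in one variable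
  via `MvPolynomial.uniqueAlgEquiv`, has degree `≤ μ` and unit leading coefficient; `isIntegral_leadingCoeff_smul`).

Fact-free, def-free. [OURS plumbing; prover res-inputs-p-6.]  AI-written; weaker than expert review.

## Sources
* H. Matsumura, *Commutative Ring Theory* (1986), §9 (integral extensions, integrally closed domains). [Matsumura1987]
-/

noncomputable section

namespace Literature.AlgebraicGeometry.Resolution

universe u v

/-- **An `S`-rational integral element comes from `S`.** Let `S` be an integrally closed domain, `K` a field that is an
`S`-algebra with injective structure map, `t ∈ K` integral over `S` with `c • t = b` for some `b, c ∈ S`, `c ≠ 0`.  Then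
`t = algebraMap S K a` for some `a ∈ S` (the fraction `b/c ∈ Frac S` is integral over `S`, hence in `S`).
[cite: Matsumura1987, §9 (integrally closed domains), p. 64] -/
theorem exists_algebraMap_eq_of_isIntegral_of_mul_eq {S : Type u} {K : Type v} [CommRing S] [IsDomain S]
    [IsIntegrallyClosed S] [Field K] [Algebra S K] [FaithfulSMul S K] {t : K} (ht : IsIntegral S t)
    {b c : S} (hc : c ≠ 0) (h : algebraMap S K c * t = algebraMap S K b) :
    ∃ a : S, algebraMap S K a = t := by
  -- the fraction field and its embedding into `K`
  let F := FractionRing S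
  have hinj : Function.Injective (algebraMap S K) := FaithfulSMul.algebraMap_injective S K
  have hinj' : Function.Injective (Algebra.ofId S K) := hinj
  let j : F →ₐ[S] K := IsFractionRing.liftAlgHom hinj'
  have hjc : j (algebraMap S F c) ≠ 0 := by
    rw [AlgHom.commutes]
    exact fun h0 => hc (hinj (by rw [h0, map_zero]))
  -- `β = b/c ∈ F` maps to `t`
  set β : F := algebraMap S F b / algebraMap S F c with hβ
  have hcF : algebraMap S F c ≠ 0 := fun h0 => hc (IsFractionRing.injective S F (by rw [h0, map_zero]))
  have hjβ : j β = t := by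
    have hct : algebraMap S K c ≠ 0 := fun h0 => hc (hinj (by rw [h0, map_zero]))
    rw [hβ, map_div₀, AlgHom.commutes, AlgHom.commutes]
    field_simp
    rw [← h, mul_comm]
  -- `β` is integral over `S` (transport along the injective `j`), hence in `S`
  have hβint : IsIntegral S β := by
    rw [← isIntegral_algHom_iff j j.toRingHom.injective, hjβ]
    exact ht
  obtain ⟨a, ha⟩ := IsIntegrallyClosed.isIntegral_iff.mp hβint
  refine ⟨a, ?_⟩
  rw [← hjβ, ← ha, AlgHom.commutes]


open _root_.MvPolynomial in
/-- **Integrality from a binary form with unit extreme coefficient.** Let `F ∈ R[Y_0, Y_1]` be a form of degree `μ`,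
`j ≠ l` the two indices, `ψ : R → K` a ring map to a field and `q : R → A` a ring map to an `A` with `A → K` compatible.
If `F(Y_j := 1)(t) = 0` in `K` and the coefficient of `Y_l^μ` in `F` becomes a unit in `A`, then `t` is integral over `A`.
[cite: Matsumura1987, §9 p. 64] -/
theorem isIntegral_of_eval₂_dehomogenize_eq_zero {R A K : Type*} [CommRing R] [CommRing A] [Field K]
    [Algebra A K] (ψ : R →+* K) (q : R →+* A) (hq : ∀ r, algebraMap A K (q r) = ψ r)
    {F : MvPolynomial (Fin 2) R} {μ : ℕ} (hF : F.IsHomogeneous μ) {j l : Fin 2} (hl : l ≠ j)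
    {t : K} (hroot : MvPolynomial.eval₂ ψ (fun _ => t) (dehomogenize j F) = 0)
    (hu : IsUnit (q (F.coeff (Finsupp.single l μ)))) : IsIntegral A t := by
  classical
  haveI : Unique {i : Fin 2 // i ≠ j} := (finSuccAboveEquiv j).symm.unique
  set G := dehomogenize j F with hG
  set p : Polynomial R := MvPolynomial.uniqueAlgEquiv R {i : Fin 2 // i ≠ j} G with hp
  set P : Polynomial A := p.map q with hP
  -- `P(t) = 0`
  have hcomp : (algebraMap A K).comp q = ψ := RingHom.ext hq
  have hPt : Polynomial.aeval t P = 0 := by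
    rw [Polynomial.aeval_def, hP, Polynomial.eval₂_map, hcomp, hp, eval₂_const_uniqueAlgEquiv]
    exact hroot
  -- the coefficients of `P`
  have hdef : (default : {i : Fin 2 // i ≠ j}) = ⟨l, hl⟩ := Subsingleton.elim _ _
  have hcoeffμ : P.coeff μ = q (F.coeff (Finsupp.single l μ)) := by
    rw [hP, Polynomial.coeff_map, hp, coeff_uniqueAlgEquiv, hdef]
    have hsub : (Finsupp.single l μ : Fin 2 →₀ ℕ).subtypeDomain (· ≠ j) =
        Finsupp.single (⟨l, hl⟩ : {i : Fin 2 // i ≠ j}) μ := by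
      ext
      simp only [Finsupp.subtypeDomain_apply, Finsupp.single_apply, Subtype.ext_iff]
    rw [← hsub, hG, coeff_dehomogenize_of_isHomogeneous j hF]
    rw [Finsupp.degree_single]
  have hdeg : P.natDegree ≤ μ := by
    refine (Polynomial.natDegree_map_le).trans ?_
    rw [Polynomial.natDegree_le_iff_coeff_eq_zero]
    intro n hn
    rw [hp, coeff_uniqueAlgEquiv]
    refine MvPolynomial.coeff_eq_zero_of_totalDegree_lt ?_
    have hGdeg : G.totalDegree ≤ μ := (totalDegree_dehomogenize_le j F).trans hF.totalDegree_le
    have hsum : ∑ i ∈ (Finsupp.single (default : {i : Fin 2 // i ≠ j}) n).support,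
        (Finsupp.single (default : {i : Fin 2 // i ≠ j}) n) i = n := by
      have hn0 : n ≠ 0 := by omega
      simp [Finsupp.support_single, hn0]
    rw [hsum]
    exact lt_of_le_of_lt hGdeg hn
  -- leading coefficient and integrality
  by_cases hA : Subsingleton A
  · haveI := hA
    exact (one_ne_zero (α := K)
      (by rw [← map_one (algebraMap A K), Subsingleton.elim (1 : A) 0, map_zero])).elim
  rw [not_subsingleton_iff_nontrivial] at hA
  haveI := hA
  have hne : P.coeff μ ≠ 0 := by rw [hcoeffμ]; exact hu.ne_zero
  have hnat : P.natDegree = μ := Polynomial.natDegree_eq_of_le_of_coeff_ne_zero hdeg hne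
  have hlead : P.leadingCoeff = q (F.coeff (Finsupp.single l μ)) := by
    rw [Polynomial.leadingCoeff, hnat, hcoeffμ]
  have hint : IsIntegral A (P.leadingCoeff • t) := isIntegral_leadingCoeff_smul P t hPt
  rw [hlead] at hint
  obtain ⟨v, hv⟩ := hu
  have ht : t = ((v⁻¹ : Aˣ) : A) • (q (F.coeff (Finsupp.single l μ)) • t) := by
    rw [← hv, smul_smul, Units.inv_mul, one_smul]
  rw [ht]
  exact hint.smul _


end Literature.AlgebraicGeometry.Resolution

end
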